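/-
COR-CM (cell pub-hodgecm2, stage 2 of the Hodge ladder) — count-neutral KERNEL COMBINATORICS «the sheared dihedral family», part XIII: places along a
slice datum (seat prover-pub-hodgecm2-b23-g52-0, binder prover b23, gen 52; claim «SYLOW TRANSFER XII + THE SHEARED DIHEDRAL FAMILY», HOME/INBOX.md
l.23708).  PORT of gen 44ʼs `Census/QuarticInversionPlaces.lean` over `SliceDatum` (the file never uses `t²`): one bookkeeping definition with body
(`word`) + theorems, on parts VII/VIII and gen 44ʼs `Census/QuarticInversionFaces.lean` BY NAME; no `decide` beyond closed identities in
`ZMod 2`/`Fin 4`, no certificate, no named fact, no `sorry`.  `Interfaces.lean` (C1), every E term, B01, `Transposition/*`, `PortJoin/*`, `D2Bridge/*`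
untouched.  HONEST FRAMING: `HC_CM` is NOT proved, here or anywhere in the tree; nothing here is a period, a count of record or a headline.
-/
import Summits.HodgeConjecture.CorCM.Census.ShearedDihedralSliceBaseChange
import Summits.HodgeConjecture.CorCM.Census.QuarticInversionFaces

/-!
# The sheared dihedral family, XIII: the words `gₖ·ι(e,s)` of a slice datum — places, membership, flips

gen 44ʼs part on places, verbatim over a slice datum `D` (`t² = 1` is never used): the four coset words `word k a` (`ι a`, `y ι a`, `t ι a`, `t y ι a`),
`exists_word`, `word_eq_word_iff`, `c_mul_word`, places `word_mem_orb_word_iff`, the coordinates of a type `coord_ty`/`word_mem_iff`, and flips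
`ty_oflipCM_word`/`oflipCM_word_typeOf`/**`typeOf_flipAt`** (the abstract flip at the place of `word p.1 (0,p.2)` is the model flip `flipAt p`),
`word_not_mem_orb_of_ne`.  All [folklore].

## References
* [Pohlmann1968] H. Pohlmann, Algebraic cycles on abelian varieties of complex multiplication type, Ann. of Math. 88 (1968), Thm 1.
-/

namespace Summit.HodgeConjecture.CorCM.Census.ShearedDihedral

open Summit.HodgeConjecture.CorCM.Census.QuarticInversion

open Finset
open Summit.HodgeConjecture.CorCM.Prior.AllgGroup.RfwfAllgGroup
open Summit.HodgeConjecture.CorCM.Census.BlockParity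
open Summit.HodgeConjecture.CorCM.Census.OddSliceFacesModel

noncomputable section

variable {G : Type*} [Group G] [Fintype G] [DecidableEq G] {c : G}
variable {A : Type} [AddCommGroup A] [Fintype A] [DecidableEq A] {ζ : ZMod 2}
variable (D : SliceDatum G c A ζ)

/-! ## §1 The coset words and their places -/

/-- **The coset words** `ι a`, `y ι a`, `t ι a`, `t y ι a`. [folklore] -/
def word (k : Fin 4) (a : ZMod 2 × A) : G := ![D.ι a, D.y * D.ι a, D.t * D.ι a, D.t * (D.y * D.ι a)] k

omit [Fintype G] [DecidableEq G] [Fintype A] [DecidableEq A] in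
/-- Every element of `G` is a coset word. [folklore] -/
theorem exists_word (g : G) : ∃ k a, g = word D k a := by
  obtain ⟨a, h | h | h | h⟩ := D.exhaust g
  · exact ⟨0, a, h⟩
  · exact ⟨1, a, h⟩
  · exact ⟨2, a, h⟩
  · exact ⟨3, a, h⟩

omit [Fintype G] [DecidableEq G] [Fintype A] [DecidableEq A] in
/-- **Two words coincide iff index and parameter do.** [folklore] -/
theorem word_eq_word_iff (n k : Fin 4) (b a : ZMod 2 × A) : word D n b = word D k a ↔ n = k ∧ b = a := by
  constructor
  · intro h
    fin_cases n <;> fin_cases k <;>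
      simp only [word, Matrix.cons_val_zero, Matrix.cons_val_one, Matrix.cons_val_two, Matrix.cons_val_three, Matrix.head_cons,
        Matrix.tail_cons, Fin.zero_eta, Fin.mk_one, Fin.reduceFinMk] at h
    · exact ⟨rfl, D.inj h⟩
    · exact absurd h (ι_ne_yι D _ _)
    · exact absurd h (ι_ne_tι D _ _)
    · exact absurd h (ι_ne_tyι D _ _)
    · exact absurd h.symm (ι_ne_yι D _ _)
    · exact ⟨rfl, yι_injective D h⟩
    · exact absurd h (yι_ne_tι D _ _)
    · exact absurd h (yι_ne_tyι D _ _)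
    · exact absurd h.symm (ι_ne_tι D _ _)
    · exact absurd h.symm (yι_ne_tι D _ _)
    · exact ⟨rfl, tι_injective D h⟩
    · exact absurd h (tι_ne_tyι D _ _)
    · exact absurd h.symm (ι_ne_tyι D _ _)
    · exact absurd h.symm (yι_ne_tyι D _ _)
    · exact absurd h.symm (tι_ne_tyι D _ _)
    · exact ⟨rfl, tyι_injective D h⟩
  · rintro ⟨rfl, rfl⟩; rfl

omit [Fintype G] [DecidableEq G] [Fintype A] [DecidableEq A] in
/-- **`c · word k a = word k ((1,0) + a)`.** [folklore] -/
theorem c_mul_word (k : Fin 4) (a : ZMod 2 × A) : c * word D k a = word D k ((1, 0) + a) := by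
  obtain ⟨e, s⟩ := a
  have h10 : ((1 : ZMod 2), (0 : A)) + (e, s) = (e + 1, s) := by ext <;> simp [add_comm]
  fin_cases k
  · show c * D.ι (e, s) = D.ι ((1, 0) + (e, s)); rw [h10, c_mul_ι_mk]
  · show c * (D.y * D.ι (e, s)) = D.y * D.ι ((1, 0) + (e, s)); rw [h10, c_mul_yι]
  · show c * (D.t * D.ι (e, s)) = D.t * D.ι ((1, 0) + (e, s)); rw [h10, c_mul_tι]
  · show c * (D.t * (D.y * D.ι (e, s))) = D.t * (D.y * D.ι ((1, 0) + (e, s))); rw [h10, c_mul_tyι]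

omit [Fintype G] [Fintype A] [DecidableEq A] in
/-- **The place of a word**: `word n b ∈ {word k a, c·word k a} ↔ n = k ∧ b.2 = a.2`. [folklore] -/
theorem word_mem_orb_word_iff (n k : Fin 4) (b a : ZMod 2 × A) : word D n b ∈ orb c (word D k a) ↔ n = k ∧ b.2 = a.2 := by
  rw [mem_orb, c_mul_word, word_eq_word_iff, word_eq_word_iff]
  have key : ∀ u v : ZMod 2, u = v ∨ u = 1 + v := by decide
  constructor
  · rintro (⟨rfl, rfl⟩ | ⟨rfl, rfl⟩)
    · exact ⟨rfl, rfl⟩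
    · exact ⟨rfl, by simp⟩
  · rintro ⟨rfl, h⟩
    obtain ⟨e, s⟩ := b
    obtain ⟨e', s'⟩ := a
    simp only at h
    subst h
    rcases key e e' with rfl | rfl
    · exact Or.inl ⟨rfl, rfl⟩
    · exact Or.inr ⟨rfl, by ext <;> simp⟩

omit [Fintype A] [DecidableEq A] in
/-- The coordinates of the label quadruple of a type. [folklore] -/
theorem coord_ty (Ψ : CMF G c) (n : Fin 4) : coord A n (ty D Ψ) = fun s => if word D n (0, s) ∈ Ψ.1 then 0 else 1 := by
  fin_cases n <;> rfl

omit [Fintype A] [DecidableEq A] in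
/-- **Membership of words**: `word n (e, s) ∈ Ψ ↔ coord n (ty Ψ) s = e`. [folklore] -/
theorem word_mem_iff (Ψ : CMF G c) (n : Fin 4) (e : ZMod 2) (s : A) : word D n (e, s) ∈ Ψ.1 ↔ coord A n (ty D Ψ) s = e := by
  fin_cases n
  · exact ι_mem_iff D Ψ e s
  · exact yι_mem_iff D Ψ e s
  · exact tι_mem_iff D Ψ e s
  · exact tyι_mem_iff D Ψ e s

/-! ## §2 Flips -/

omit [Fintype A] in
/-- **A flip at the place of `word k a` flips the `k`-th label at `a.2`**: `ty (Φ ∆ place) = flipAt (k, a.2) (ty Φ)`. [folklore] -/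
theorem ty_oflipCM_word (hc2 : c * c = 1) (k : Fin 4) (a : ZMod 2 × A) (Φ : CMF G c) :
    ty D (oflipCM c hc2 (word D k a) Φ) = flipAt A (k, a.2) (ty D Φ) := by
  refine ext_coord A fun n => ?_
  rw [coord_flipAt, coord_ty, coord_ty]
  funext s
  rw [Pi.add_apply]
  show (if word D n (0, s) ∈ oflip c (word D k a) Φ.1 then (0 : ZMod 2) else 1) = _
  have hb : bump A n (k, a.2) s = if (n = k ∧ s = a.2) then 1 else 0 := by
    unfold bump
    by_cases hnk : n = k
    · subst hnk; rw [if_pos rfl, delta_apply]; by_cases hs : s = a.2 <;> simp [hs]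
    · rw [if_neg hnk, if_neg (fun h => hnk h.1)]; rfl
  rw [hb]
  have h11 : (1 : ZMod 2) + 1 = 0 := by decide
  by_cases hq : (n = k ∧ s = a.2)
  · obtain ⟨rfl, rfl⟩ := hq
    have horb : word D n (0, a.2) ∈ orb c (word D n a) := (word_mem_orb_word_iff D n n (0, a.2) a).mpr ⟨rfl, rfl⟩
    by_cases hm : word D n (0, a.2) ∈ Φ.1 <;> simp [oflip, Finset.mem_symmDiff, horb, hm, h11]
  · have horb : word D n (0, s) ∉ orb c (word D k a) := fun h => hq ((word_mem_orb_word_iff D n k (0, s) a).mp h)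
    by_cases hm : word D n (0, s) ∈ Φ.1 <;> simp [oflip, Finset.mem_symmDiff, horb, hm, hq]

/-- **Flips of types of labels**: `(typeOf Θ) ∆ place (word k a) = typeOf (flipAt (k, a.2) Θ)`. [folklore] -/
theorem oflipCM_word_typeOf (hc2 : c * c = 1) (k : Fin 4) (a : ZMod 2 × A) (Θ : Ty₄ A) :
    oflipCM c hc2 (word D k a) (typeOf D Θ) = typeOf D (flipAt A (k, a.2) Θ) := by
  apply ty_injective D
  rw [ty_oflipCM_word, ty_typeOf, ty_typeOf]

/-- **The flips of the model are abstract flips**: `typeOf (flipAt (k,u) Θ) = (typeOf Θ) ∆ place (word k (0,u))`. [folklore] -/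
theorem typeOf_flipAt (hc2 : c * c = 1) (p : Pl A) (Θ : Ty₄ A) :
    typeOf D (flipAt A p Θ) = oflipCM c hc2 (word D p.1 (0, p.2)) (typeOf D Θ) := by
  rw [oflipCM_word_typeOf]

omit [Fintype G] [Fintype A] [DecidableEq A] in
/-- Distinct places of the model are distinct places of `(G, c)`. [folklore] -/
theorem word_not_mem_orb_of_ne {p q : Pl A} (hpq : p ≠ q) : word D q.1 (0, q.2) ∉ orb c (word D p.1 (0, p.2)) := by
  rw [word_mem_orb_word_iff]
  rintro ⟨h1, h2⟩
  exact hpq (Prod.ext h1.symm h2.symm)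

end

end Summit.HodgeConjecture.CorCM.Census.ShearedDihedral
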